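import Summits.Parity.BatemanHorn.Theorems.SoloInformedPolynomialRoughValues
import Mathlib.Algebra.Polynomial.Degree.SmallDegree

/-!
# The restriction of a Bateman–Horn polynomial to an arithmetic progression

Solo unit `solo-Parity-informed` (ideation tier, informed mode), session 14; `PLAN.md` §22.5(a), CLAIMS C63.

For `g ∈ ℤ[X]` forming a Bateman–Horn system, a modulus `Q = ∏_{q ∈ S} q` (distinct primes) and a
residue `r` with `q ∤ g(r)` for every `q ∈ S`, the polynomial `G_r(X) = g(QX + r)` again forms a
Bateman–Horn system (`isBatemanHornSystem_comp_C_mul_X_add_C`): it is primitive (a prime dividing its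
content divides `g(r)`, hence not `Q`, and then divides the content of `g`), irreducible over `ℚ`
(`X ↦ QX + r` is an automorphism), has the root counts `ρ_{G_r}(p) = ρ_g(p)` for `p ∤ Q` and `0` for
`p ∣ Q`, and therefore the Bateman–Horn constant
`C(G_r) = C(g) · ∏_{q ∈ S} (1 - ρ_g(q)/q)⁻¹` (`hasBatemanHornConst_comp_C_mul_X_add_C`).
This is the input that lets the one-polynomial upper-bound sieve (`SoloInformedPolynomialRoughValues`)
be run inside residue classes (`SoloInformedLocalRoughValues`).
-/

namespace Summit.Parity.BatemanHorn.Theorems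

open Finset Filter Polynomial
open scoped Topology
open Literature.NumberTheory.Sieve (polyRootCountMod IsBatemanHornSystem batemanHornPartial
  HasBatemanHornConst batemanHornConst polyRootCountMod_single polyRootCountMod_single_eq_card_zmod)

/-! ### Degree and leading coefficient -/

/-- `deg g(QX + r) = deg g` for `Q ≠ 0`. -/
theorem natDegree_comp_C_mul_X_add_C {g : ℤ[X]} {Q : ℤ} (hQ : Q ≠ 0) (r : ℤ) :
    (g.comp (C Q * X + C r)).natDegree = g.natDegree := by
  rw [natDegree_comp, natDegree_linear hQ, mul_one]

/-- `lc (g(QX + r)) = lc(g) Q^{deg g}` for `Q ≠ 0`. -/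
theorem leadingCoeff_comp_C_mul_X_add_C {g : ℤ[X]} {Q : ℤ} (hQ : Q ≠ 0) (r : ℤ) :
    (g.comp (C Q * X + C r)).leadingCoeff = g.leadingCoeff * Q ^ g.natDegree := by
  rw [leadingCoeff_comp (by rw [natDegree_linear hQ]; exact one_ne_zero), leadingCoeff_linear hQ]

/-! ### Root counts -/

/-- For a prime `p ∤ Q`, `g(QX + r)` and `g` have the same number of roots mod `p`
(`x ↦ Qx + r` permutes `ℤ/p`). -/
theorem polyRootCountMod_comp_C_mul_X_add_C_of_not_dvd (g : ℤ[X]) {Q : ℕ} (r : ℤ) {p : ℕ}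
    (hp : p.Prime) (hpQ : ¬ p ∣ Q) :
    polyRootCountMod ![g.comp (C (Q : ℤ) * X + C r)] p = polyRootCountMod ![g] p := by
  classical
  haveI := Fact.mk hp
  have hQ : (Q : ZMod p) ≠ 0 := by rw [Ne, ZMod.natCast_eq_zero_iff]; exact hpQ
  rw [polyRootCountMod_single_eq_card_zmod, polyRootCountMod_single_eq_card_zmod]
  have hev : ∀ x : ZMod p,
      ((g.comp (C (Q : ℤ) * X + C r)).map (Int.castRingHom (ZMod p))).eval x
        = (g.map (Int.castRingHom (ZMod p))).eval ((Q : ZMod p) * x + (r : ZMod p)) := by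
    intro x
    rw [Polynomial.map_comp]
    simp [eval_comp]
  refine card_bij (fun x _ => (Q : ZMod p) * x + (r : ZMod p)) ?_ ?_ ?_
  · intro x hx
    simp only [mem_filter, mem_univ, true_and] at hx ⊢
    rwa [hev] at hx
  · intro x _ y _ hxy
    exact mul_left_cancel₀ hQ (add_right_cancel hxy)
  · intro y hy
    simp only [mem_filter, mem_univ, true_and] at hy
    refine ⟨(Q : ZMod p)⁻¹ * (y - r), ?_, ?_⟩
    · simp only [mem_filter, mem_univ, true_and]
      rw [hev, mul_inv_cancel_left₀ hQ, sub_add_cancel]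
      exact hy
    · rw [mul_inv_cancel_left₀ hQ, sub_add_cancel]

/-- For `p ∣ Q` with `p ∤ g(r)`, `g(QX + r)` has no roots mod `p` (`g(Qm + r) ≡ g(r)`). -/
theorem polyRootCountMod_comp_C_mul_X_add_C_of_dvd (g : ℤ[X]) {Q : ℕ} {r : ℤ} {p : ℕ}
    (hpQ : p ∣ Q) (hpr : ¬ (p : ℤ) ∣ g.eval r) :
    polyRootCountMod ![g.comp (C (Q : ℤ) * X + C r)] p = 0 := by
  rw [polyRootCountMod_single, card_eq_zero, filter_eq_empty_iff]
  intro n _ hn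
  apply hpr
  simp only [eval_comp, eval_add, eval_mul, eval_C, eval_X] at hn
  have hsub : (Q : ℤ) * n + r - r ∣ g.eval ((Q : ℤ) * n + r) - g.eval r := sub_dvd_eval_sub _ _ _
  rw [add_sub_cancel_right] at hsub
  have h : (p : ℤ) ∣ g.eval ((Q : ℤ) * n + r) - g.eval r :=
    ((Int.natCast_dvd_natCast.mpr hpQ).mul_right _).trans hsub
  exact (dvd_sub_right hn).mp h

/-! ### Primitivity and irreducibility -/

/-- If `g` is primitive and no prime factor of `Q ≠ 0` divides `g(r)`, then `g(QX + r)` is primitive. -/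
theorem isPrimitive_comp_C_mul_X_add_C {g : ℤ[X]} (hprim : g.IsPrimitive) {Q : ℕ} (hQ : Q ≠ 0)
    {r : ℤ} (hr : ∀ p : ℕ, p.Prime → p ∣ Q → ¬ (p : ℤ) ∣ g.eval r) :
    (g.comp (C (Q : ℤ) * X + C r)).IsPrimitive := by
  classical
  set G := g.comp (C (Q : ℤ) * X + C r) with hG
  have hQz : (Q : ℤ) ≠ 0 := by exact_mod_cast hQ
  have hG0 : G ≠ 0 := by
    intro h
    have h1 : G.leadingCoeff = 0 := by rw [h, leadingCoeff_zero]
    rw [hG, leadingCoeff_comp_C_mul_X_add_C hQz] at h1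
    exact mul_ne_zero (leadingCoeff_ne_zero.mpr hprim.ne_zero) (pow_ne_zero _ hQz) h1
  intro k hk
  by_contra hku
  have hk1 : k.natAbs ≠ 1 := fun h => hku (Int.isUnit_iff_natAbs_eq.mpr h)
  obtain ⟨ℓ, hℓ, hℓk⟩ := Nat.exists_prime_and_dvd hk1
  haveI := Fact.mk hℓ
  have hℓG : ∀ i, (ℓ : ℤ) ∣ G.coeff i := by
    rw [← C_dvd_iff_dvd_coeff]
    exact (map_dvd C (Int.natCast_dvd.mpr hℓk)).trans hk
  -- `ℓ ∣ G(0) = g(r)`, so `ℓ ∤ Q`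
  have hℓr : (ℓ : ℤ) ∣ g.eval r := by
    have h := hℓG 0
    rw [coeff_zero_eq_eval_zero, hG] at h
    simpa [eval_comp] using h
  have hℓQ : ¬ ℓ ∣ Q := fun h => hr ℓ hℓ h hℓr
  have hQl : (Q : ZMod ℓ) ≠ 0 := by rw [Ne, ZMod.natCast_eq_zero_iff]; exact hℓQ
  -- `G ≡ 0 (mod ℓ)`, i.e. `(g mod ℓ)(QX + r) = 0`, forces `g ≡ 0 (mod ℓ)`
  have hGmod : G.map (Int.castRingHom (ZMod ℓ)) = 0 := by
    ext i
    rw [coeff_map, coeff_zero, eq_intCast, ZMod.intCast_zmod_eq_zero_iff_dvd]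
    exact hℓG i
  have hcomp : (g.map (Int.castRingHom (ZMod ℓ))).comp (C (Q : ZMod ℓ) * X + C (r : ZMod ℓ)) = 0 := by
    rw [hG, Polynomial.map_comp] at hGmod
    simpa using hGmod
  rw [comp_eq_zero_iff] at hcomp
  have hgmod : g.map (Int.castRingHom (ZMod ℓ)) = 0 := by
    rcases hcomp with h | ⟨-, h⟩
    · exact h
    · have h1 := congrArg (fun p : (ZMod ℓ)[X] => p.coeff 1) h
      simp only [coeff_add, coeff_C_mul, coeff_X_one, mul_one, coeff_C_succ, add_zero] at h1
      exact absurd h1 hQl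
  have hCg : C (ℓ : ℤ) ∣ g := by
    rw [C_dvd_iff_dvd_coeff]
    intro i
    have h : (g.map (Int.castRingHom (ZMod ℓ))).coeff i = 0 := by rw [hgmod, coeff_zero]
    rwa [coeff_map, eq_intCast, ZMod.intCast_zmod_eq_zero_iff_dvd] at h
  have hu := hprim _ hCg
  rw [Int.isUnit_iff_natAbs_eq, Int.natAbs_natCast] at hu
  exact hℓ.one_lt.ne' hu

/-- If `g` is irreducible of positive degree and no prime factor of `Q ≠ 0` divides `g(r)`, then
`g(QX + r)` is irreducible in `ℤ[X]` (Gauss: primitive and irreducible over `ℚ`). -/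
theorem irreducible_comp_C_mul_X_add_C {g : ℤ[X]} (hirr : Irreducible g) (hdeg : g.natDegree ≠ 0)
    {Q : ℕ} (hQ : Q ≠ 0) {r : ℤ} (hr : ∀ p : ℕ, p.Prime → p ∣ Q → ¬ (p : ℤ) ∣ g.eval r) :
    Irreducible (g.comp (C (Q : ℤ) * X + C r)) := by
  have hprim : g.IsPrimitive := hirr.isPrimitive hdeg
  have hprimG := isPrimitive_comp_C_mul_X_add_C hprim hQ hr
  have hirrQ : Irreducible (g.map (algebraMap ℤ ℚ)) :=
    (hprim.irreducible_iff_irreducible_map_fraction_map (K := ℚ)).mp hirr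
  haveI : Invertible (Q : ℚ) := invertibleOfNonzero (by exact_mod_cast hQ)
  have h := (MulEquiv.irreducible_iff (algEquivCMulXAddC (Q : ℚ) (r : ℚ))).2 hirrQ
  rw [algEquivCMulXAddC_apply, ← comp_eq_aeval] at h
  have hmap : (g.comp (C (Q : ℤ) * X + C r)).map (algebraMap ℤ ℚ)
      = (g.map (algebraMap ℤ ℚ)).comp (C (Q : ℚ) * X + C (r : ℚ)) := by
    rw [Polynomial.map_comp]
    simp
  refine (hprimG.irreducible_iff_irreducible_map_fraction_map (K := ℚ)).mpr ?_
  rw [hmap]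
  exact h

/-! ### The Bateman–Horn system `g(QX + r)` -/

/-- **`g(QX + r)` is a Bateman–Horn system** when `g` is one, `Q ≠ 0`, and no prime factor of `Q`
divides `g(r)`. -/
theorem isBatemanHornSystem_comp_C_mul_X_add_C {g : ℤ[X]} (hg : IsBatemanHornSystem ![g]) {Q : ℕ}
    (hQ : Q ≠ 0) {r : ℤ} (hr : ∀ p : ℕ, p.Prime → p ∣ Q → ¬ (p : ℤ) ∣ g.eval r) :
    IsBatemanHornSystem ![g.comp (C (Q : ℤ) * X + C r)] := by
  have hirr : Irreducible g := by simpa using hg.irreducible 0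
  have hlc : 0 < g.leadingCoeff := by simpa using hg.leadingCoeff_pos 0
  have hdeg : 0 < g.natDegree := by simpa using hg.natDegree_pos 0
  have hQz : (Q : ℤ) ≠ 0 := by exact_mod_cast hQ
  refine ⟨fun i => ?_, fun i => ?_, Subsingleton.pairwise, fun p hp => ?_⟩
  · fin_cases i
    simpa using irreducible_comp_C_mul_X_add_C hirr hdeg.ne' hQ hr
  · fin_cases i
    simp only [Fin.zero_eta, Matrix.cons_val_zero]
    rw [leadingCoeff_comp_C_mul_X_add_C hQz]
    positivity
  · by_cases hpQ : p ∣ Q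
    · rw [polyRootCountMod_comp_C_mul_X_add_C_of_dvd g hpQ (hr p hp hpQ)]
      exact hp.pos
    · rw [polyRootCountMod_comp_C_mul_X_add_C_of_not_dvd g r hp hpQ]
      exact hg.hasNoFixedPrimeDivisor p hp

/-! ### The constant -/

/-- The partial products of the constant of `g(QX + r)`, `Q = ∏_{q ∈ S} q`, for `x ≥ max S`:
`∏_{p ≤ x}^{(G_r)} = ∏_{p ≤ x}^{(g)} · ∏_{q ∈ S} (1 - ρ_g(q)/q)⁻¹`. -/
theorem batemanHornPartial_comp_C_mul_X_add_C {g : ℤ[X]} (hg : IsBatemanHornSystem ![g])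
    {S : Finset ℕ} (hS : ∀ q ∈ S, q.Prime) {r : ℤ} (hr : ∀ q ∈ S, ¬ (q : ℤ) ∣ g.eval r) {x : ℕ}
    (hx : ∀ q ∈ S, q ≤ x) :
    batemanHornPartial ![g.comp (C ((∏ q ∈ S, q : ℕ) : ℤ) * X + C r)] x
      = batemanHornPartial ![g] x * ∏ q ∈ S, (1 - (polyRootCountMod ![g] q : ℝ) / q)⁻¹ := by
  classical
  set Q : ℕ := ∏ q ∈ S, q with hQ
  have hdvdQ : ∀ {p : ℕ}, p.Prime → (p ∣ Q ↔ p ∈ S) := by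
    intro p hp
    rw [hQ, hp.prime.dvd_finsetProd_iff]
    constructor
    · rintro ⟨q, hq, hpq⟩
      rwa [(Nat.prime_dvd_prime_iff_eq hp (hS q hq)).mp hpq]
    · intro hpS
      exact ⟨p, hpS, dvd_rfl⟩
  have hρ : ∀ p ∈ Nat.primesLE x, (polyRootCountMod ![g.comp (C (Q : ℤ) * X + C r)] p : ℝ)
      = if p ∈ S then 0 else (polyRootCountMod ![g] p : ℝ) := by
    intro p hp
    have hpp : p.Prime := (Nat.mem_primesBelow.mp hp).2
    split_ifs with hpS
    · rw [polyRootCountMod_comp_C_mul_X_add_C_of_dvd g ((hdvdQ hpp).mpr hpS) (hr p hpS), Nat.cast_zero]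
    · rw [polyRootCountMod_comp_C_mul_X_add_C_of_not_dvd g r hpp (fun h => hpS ((hdvdQ hpp).mp h))]
  have hne : ∀ q ∈ S, (1 - (polyRootCountMod ![g] q : ℝ) / q) ≠ 0 := by
    intro q hq
    have hqp := hS q hq
    have hlt : (polyRootCountMod ![g] q : ℝ) < q := by
      exact_mod_cast hg.hasNoFixedPrimeDivisor q hqp
    have hq0 : (0 : ℝ) < q := by exact_mod_cast hqp.pos
    rw [sub_ne_zero, ne_comm, Ne, div_eq_one_iff_eq hq0.ne']
    exact hlt.ne
  unfold batemanHornPartial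
  simp only [Fintype.card_unique, pow_one]
  rw [← inter_eq_right.mpr (show S ⊆ Nat.primesLE x from fun q hq =>
    Nat.mem_primesBelow.mpr ⟨Nat.lt_succ_of_le (hx q hq), hS q hq⟩), ← prod_ite_mem,
    ← prod_mul_distrib]
  refine prod_congr rfl fun p hp => ?_
  rw [hρ p hp]
  split_ifs with hpS
  · rw [zero_div, sub_zero, mul_one, mul_assoc, mul_inv_cancel₀ (hne p hpS), mul_one]
  · rw [mul_one]

/-- **The Bateman–Horn constant of `g(QX + r)`** (`Q = ∏_{q ∈ S} q`, `q ∤ g(r)` for `q ∈ S`):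
`C(G_r) = C(g) · ∏_{q ∈ S} (1 - ρ_g(q)/q)⁻¹`. -/
theorem hasBatemanHornConst_comp_C_mul_X_add_C {g : ℤ[X]} (hg : IsBatemanHornSystem ![g])
    {S : Finset ℕ} (hS : ∀ q ∈ S, q.Prime) {r : ℤ} (hr : ∀ q ∈ S, ¬ (q : ℤ) ∣ g.eval r) :
    HasBatemanHornConst ![g.comp (C ((∏ q ∈ S, q : ℕ) : ℤ) * X + C r)]
      (batemanHornConst ![g] * ∏ q ∈ S, (1 - (polyRootCountMod ![g] q : ℝ) / q)⁻¹) := by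
  have hC := (IsBatemanHornSystem.hasBatemanHornConst_holds hg).1
  unfold HasBatemanHornConst at hC ⊢
  have hev : ∀ᶠ x : ℕ in atTop, batemanHornPartial ![g.comp (C ((∏ q ∈ S, q : ℕ) : ℤ) * X + C r)] x
      = batemanHornPartial ![g] x * ∏ q ∈ S, (1 - (polyRootCountMod ![g] q : ℝ) / q)⁻¹ := by
    filter_upwards [eventually_ge_atTop (S.sup id)] with x hx
    exact batemanHornPartial_comp_C_mul_X_add_C hg hS hr (fun q hq => (Finset.le_sup (f := id) hq).trans hx)
  rw [tendsto_congr' hev]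
  exact hC.mul_const _

/-- The constant of `g(QX + r)` as a number: `batemanHornConst = C(g) ∏ (1 - ρ_g(q)/q)⁻¹`, positive. -/
theorem batemanHornConst_comp_C_mul_X_add_C {g : ℤ[X]} (hg : IsBatemanHornSystem ![g])
    {S : Finset ℕ} (hS : ∀ q ∈ S, q.Prime) {r : ℤ} (hr : ∀ q ∈ S, ¬ (q : ℤ) ∣ g.eval r) :
    batemanHornConst ![g.comp (C ((∏ q ∈ S, q : ℕ) : ℤ) * X + C r)]
      = batemanHornConst ![g] * ∏ q ∈ S, (1 - (polyRootCountMod ![g] q : ℝ) / q)⁻¹ :=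
  (hasBatemanHornConst_comp_C_mul_X_add_C hg hS hr).batemanHornConst_eq

end Summit.Parity.BatemanHorn.Theorems
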